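import Summits.Ventures.YMGap.RobustBall.ZNFluxPeeling
import Summits.Ventures.YMGap.RobustBall.ZNSpinTwoPoint
import Summits.Ventures.YMGap.RobustBall.FiniteGibbsInfluenceW
import HarnessLib

/-!
# RobustBall/ZNFluxWindowLayer — `ℤ_N` lattice gauge theories with FINITE-RANGE flux interactions
# `exp(∑_t g_t(flux|_{supp t}))`: the block-conditioned `i`-layer system (selected layers free, all other links
# frozen), its Dobrushin row sums, its layer `ℤ_N` symmetry and the windowed two-point bound `4 c^{⌈T/r⌉}`

HONEST FRAMING: venture file of the cell `pub-ymgap` (QuantumFields programme), track Y2 ROBUST-BALL, seat ds-4 g8.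
Finite sums on a finite torus; no `SU(N)` measure, no area law yet (`ZNFluxWindowPeeling`); nothing about the continuum.

WHAT THIS IS: the layer mechanism of `ZNFluxLayer` (single-plaquette flux weights) for MULTI-PLAQUETTE flux interactions.
Terms `t : ι` carry a plaquette support `supp t`, an activity `g t` reading the flux configuration
`flux k : plaquettes → ℤ/N` only on `supp t` (`DependsOn`), and a bound `|g t| ≤ B t`.  Given the transverse links `kT`
and a frozen configuration `κ` of the `i`-links OFF a set of selected `i`-heights `H`, the free `i`-links form the finite
spin system `σ : Site d L → ℤ/N` (off-`H` coordinates are dummies) with weight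
`layerWeightW = exp(∑_t g_t(flux(glue (H.piecewise σ κ) kT)))`:
* influences (`tv_layerWeightW_le`): `tv ≤ ∑_{t : y, y' ∈ iLinks i (supp t)} B t` (`FiniteGibbs.tv_le_of_exp_sum_weighted`);
  row sums `≤ ∑_{t ∋ y} B t (|iLinks i (supp t)| − 1)` (`rowsum_layerCW_le`);
* symmetry (`layerWeightW_add_const`): shifting the free `i`-links by `1` changes no flux (both `i`-links of an
  `(i,v)`-plaquette sit at the same `i`-height), so one-point functions vanish (`N ≥ 2`);
* profile `⌈dist_j(t, ·)/r⌉` is `1`-Lipschitz along the influence graph when every term's `i`-links have `j`-extent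
  `≤ r` (`profile_le_of_mem_layerNbrW`);
* **`norm_cavg_ψ_sub_le_window`**: row sums `≤ c ≤ 1` ⇒ `‖E ψ(σ_b − σ_t)‖ ≤ 4 · c^{⌈dist_j(t,b)/r⌉}`.
References for the mechanism: Mack–Petkova 1979 §2; Durhuus–Fröhlich 1980; Georgii 2011 Prop. 8.8 / Thm. 8.20.
-/

noncomputable section

open Finset Function
open Literature.MathematicalPhysics.QuantumFieldTheory

namespace Summit.Ventures.YMGap.RobustBall

namespace ZNFluxW

open ZN

variable {d L N : ℕ} [NeZero L] [NeZero N] {ι : Type*} [Fintype ι]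

/-! ### Flux configurations and flux-local term families -/

/-- The flux (discrete curl) configuration of `k : links → ℤ/N`. [folklore] -/
def flux (k : Edge d L → ZMod N) (p : Plaquette d L) : ZMod N := plaqSum k p.1 p.2.1.1 p.2.1.2

/-- The `i`-links (by base point) read by the fluxes of a plaquette set. [folklore] -/
def iLinks (i : Fin d) (Y : Finset (Plaquette d L)) : Finset (Site d L) := Y.biUnion (iSites i)

/-- **The `ℤ_N` weight with finite-range flux interactions** `exp(∑_t g_t(flux k))`. [folklore] -/
def znWD (g : ι → (Plaquette d L → ZMod N) → ℝ) (k : Edge d L → ZMod N) : ℝ :=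
  Real.exp (∑ t, g t (flux k))

omit [NeZero L] [NeZero N] in
/-- The weight is positive. [folklore] -/
theorem znWD_pos (g : ι → (Plaquette d L → ZMod N) → ℝ) (k : Edge d L → ZMod N) : 0 < znWD g k :=
  Real.exp_pos _

omit [NeZero L] [Fintype ι] in
/-- A flux-local term reads `kI` (through `glue`) only on the `i`-links of its support. [folklore] -/
theorem apply_flux_glue_congr {supp : ι → Finset (Plaquette d L)} {g : ι → (Plaquette d L → ZMod N) → ℝ}
    (hdep : ∀ t, DependsOn (g t) (↑(supp t) : Set (Plaquette d L))) (t : ι) (i : Fin d)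
    {kI kI' : Site d L → ZMod N} (kT : Transverse d L (ZMod N) i) (h : ∀ y ∈ iLinks i (supp t), kI y = kI' y) :
    g t (flux (glue i kI kT)) = g t (flux (glue i kI' kT)) :=
  hdep t fun p hp => plaqSum_glue_congr i kT p fun y hy =>
    h y (Finset.mem_biUnion.2 ⟨p, Finset.mem_coe.1 hp, hy⟩)

omit [NeZero L] [NeZero N] in
/-- Both `i`-sites read by a plaquette sit at the plaquette's `i`-height. [folklore] -/
theorem apply_eq_of_mem_iLinks (i : Fin d) {Y : Finset (Plaquette d L)} {y : Site d L} (hy : y ∈ iLinks i Y) :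
    ∃ p ∈ Y, y ∈ iSites i p ∧ y i = p.1 i := by
  obtain ⟨p, hp, hyp⟩ := Finset.mem_biUnion.1 hy
  exact ⟨p, hp, hyp, apply_eq_of_mem_iSites i p hyp⟩

omit [NeZero L] [NeZero N] in
/-- **Shifting the `i`-links at a set of `i`-HEIGHTS changes no flux** (each `(i,v)`-plaquette reads its two `i`-links,
both at its own `i`-height, with opposite signs; other plaquettes read no `i`-link). [folklore] -/
theorem plaqSum_glue_shift_heights (i : Fin d) (H : Finset (ZMod L)) (kI : Site d L → ZMod N)
    (kT : Transverse d L (ZMod N) i) (c : ZMod N) (p : Plaquette d L) :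
    plaqSum (glue i (fun y => if y i ∈ H then kI y + c else kI y) kT) p.1 p.2.1.1 p.2.1.2 =
      plaqSum (glue i kI kT) p.1 p.2.1.1 p.2.1.2 := by
  obtain ⟨z, ⟨⟨a, b⟩, hab⟩⟩ := p
  have hab' : a < b := hab
  simp only [plaqSum, glue]
  by_cases ha : a = i
  · subst ha
    have hb : b ≠ a := fun hba => lt_irrefl a (by rw [hba] at hab'; exact hab')
    have hz : (z.shift b) a = z a := by simp [Site.shift, Pi.single_eq_of_ne hb.symm]
    simp only [dif_pos, dif_neg hb, hz]
    split_ifs <;> ring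
  · by_cases hb : b = i
    · subst hb
      have hz : (z.shift a) b = z b := by simp [Site.shift, Pi.single_eq_of_ne (Ne.symm ha)]
      simp only [dif_neg ha, dif_pos, hz]
      split_ifs <;> ring
    · simp only [dif_neg ha, dif_neg hb]

/-! ### The block-conditioned layer system -/

/-- The free block: `i`-links at the selected heights `H`. [folklore] -/
def block (i : Fin d) (H : Finset (ZMod L)) : Finset (Site d L) := Finset.univ.filter fun y => y i ∈ H

omit [NeZero N] in
/-- Membership in the block is membership of the `i`-height in `H`. [folklore] -/
@[simp] theorem mem_block {i : Fin d} {H : Finset (ZMod L)} {y : Site d L} : y ∈ block i H ↔ y i ∈ H := by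
  simp [block]

/-- **The block-conditioned weight**: free `i`-links `σ` on the block, frozen `i`-links `κ` off the block, frozen
transverse links `kT`. [folklore] -/
def layerWeightW (g : ι → (Plaquette d L → ZMod N) → ℝ) (i : Fin d) (H : Finset (ZMod L))
    (kT : Transverse d L (ZMod N) i) (κ σ : Site d L → ZMod N) : ℝ :=
  znWD g (glue i ((block i H).piecewise σ κ) kT)

omit [NeZero N] in
/-- The block-conditioned weight is positive. [folklore] -/
theorem layerWeightW_pos (g : ι → (Plaquette d L → ZMod N) → ℝ) (i : Fin d) (H : Finset (ZMod L))
    (kT : Transverse d L (ZMod N) i) (κ σ : Site d L → ZMod N) : 0 < layerWeightW g i H kT κ σ := Real.exp_pos _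

omit [NeZero N] in
/-- **Layer `ℤ_N` symmetry of the block-conditioned weight**: shifting the free `i`-links by a constant changes no
flux. [folklore] -/
theorem layerWeightW_add_const (g : ι → (Plaquette d L → ZMod N) → ℝ) (i : Fin d) (H : Finset (ZMod L))
    (kT : Transverse d L (ZMod N) i) (κ σ : Site d L → ZMod N) (c : ZMod N) :
    layerWeightW g i H kT κ (σ + fun _ => c) = layerWeightW g i H kT κ σ := by
  unfold layerWeightW znWD flux
  have hpw : (block i H).piecewise (σ + fun _ => c) κ =
      fun y => if y i ∈ H then (block i H).piecewise σ κ y + c else (block i H).piecewise σ κ y := by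
    funext y
    by_cases hy : y i ∈ H
    · have hyB : y ∈ block i H := mem_block.2 hy
      simp [hyB, hy]
    · have hyB : y ∉ block i H := fun h => hy (mem_block.1 h)
      simp [hyB, hy]
  rw [hpw]
  simp only [plaqSum_glue_shift_heights]

/-! ### Dobrushin influences of the block-conditioned system -/

section Influence

variable (supp : ι → Finset (Plaquette d L)) (B : ι → ℝ) (i : Fin d)

/-- The influence coefficient: `∑_{t : y, y' ∈ iLinks i (supp t)} B t` (zero on the diagonal). [folklore] -/
def layerCW (y y' : Site d L) : ℝ :=
  if y' = y then 0 else ∑ t ∈ Finset.univ.filter (fun t => y ∈ iLinks i (supp t) ∧ y' ∈ iLinks i (supp t)), B t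

/-- The neighbourhood: other `i`-sites sharing a term. [folklore] -/
def layerNbrW (y : Site d L) : Finset (Site d L) :=
  Finset.univ.filter fun y' => y' ≠ y ∧ ∃ t, y ∈ iLinks i (supp t) ∧ y' ∈ iLinks i (supp t)

omit [NeZero L] in
/-- Influence coefficients are nonnegative (for `B ≥ 0`). [folklore] -/
theorem layerCW_nonneg (hB : ∀ t, 0 ≤ B t) (y y' : Site d L) : 0 ≤ layerCW supp B i y y' := by
  unfold layerCW; split_ifs
  · exact le_rfl
  · exact Finset.sum_nonneg fun t _ => hB t

/-- Influence coefficients vanish off the neighbourhood. [folklore] -/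
theorem layerCW_eq_zero (y y' : Site d L) (h : y' ∉ layerNbrW supp i y) : layerCW supp B i y y' = 0 := by
  unfold layerCW
  split_ifs with hy
  · rfl
  · rw [layerNbrW, Finset.mem_filter, not_and] at h
    have hne : ¬∃ t, y ∈ iLinks i (supp t) ∧ y' ∈ iLinks i (supp t) := fun hex => h (Finset.mem_univ _) ⟨hy, hex⟩
    rw [Finset.filter_eq_empty_iff.2 fun t _ ht => hne ⟨t, ht⟩, Finset.sum_empty]

/-- **One-site influences of the block-conditioned system.** [folklore] -/
theorem tv_layerWeightW_le {g : ι → (Plaquette d L → ZMod N) → ℝ}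
    (hdep : ∀ t, DependsOn (g t) (↑(supp t) : Set (Plaquette d L))) (hB : ∀ t φ, |g t φ| ≤ B t)
    (H : Finset (ZMod L)) (kT : Transverse d L (ZMod N) i) (κ : Site d L → ZMod N) (y y' : Site d L) (hy : y' ≠ y)
    (σ τ : Site d L → ZMod N) (hστ : ∀ z, z ≠ y' → σ z = τ z) :
    FiniteGibbs.tv (layerWeightW g i H kT κ) y σ τ ≤ layerCW supp B i y y' := by
  classical
  rw [layerCW, if_neg hy]
  refine FiniteGibbs.tv_le_of_exp_sum_weighted (fun t => iLinks i (supp t))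
    (fun t σ => g t (flux (glue i ((block i H).piecewise σ κ) kT))) (fun t σ σ' h => ?_) B (fun t σ => hB t _)
    (fun σ => rfl) hστ
  exact apply_flux_glue_congr hdep t i kT fun z hz => by
    show (block i H).piecewise σ κ z = (block i H).piecewise σ' κ z
    by_cases hzB : z ∈ block i H
    · rw [Finset.piecewise_eq_of_mem _ _ _ hzB, Finset.piecewise_eq_of_mem _ _ _ hzB, h z (Finset.mem_coe.2 hz)]
    · rw [Finset.piecewise_eq_of_notMem _ _ _ hzB, Finset.piecewise_eq_of_notMem _ _ _ hzB]

/-- **Row sums of the influences**: `∑_{y'} layerCW y y' ≤ ∑_{t ∋ y} B t · (|iLinks i (supp t)| − 1)`. [folklore] -/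
theorem rowsum_layerCW_le (hB : ∀ t, 0 ≤ B t) (y : Site d L) :
    ∑ y' ∈ layerNbrW supp i y, layerCW supp B i y y' ≤
      ∑ t ∈ Finset.univ.filter (fun t => y ∈ iLinks i (supp t)), B t * (((iLinks i (supp t)).card : ℝ) - 1) := by
  classical
  have h1 : ∑ y' ∈ layerNbrW supp i y, layerCW supp B i y y' ≤ ∑ y' ∈ Finset.univ.erase y, layerCW supp B i y y' :=
    Finset.sum_le_sum_of_subset_of_nonneg (fun y' hy' => by
      rw [layerNbrW, Finset.mem_filter] at hy'
      exact Finset.mem_erase.2 ⟨hy'.2.1, Finset.mem_univ _⟩) fun _ _ _ => layerCW_nonneg supp B i hB _ _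
  refine h1.trans ?_
  have h2 : ∀ y' ∈ Finset.univ.erase y, layerCW supp B i y y' =
      ∑ t, (if y ∈ iLinks i (supp t) ∧ y' ∈ iLinks i (supp t) then B t else 0) := by
    intro y' hy'
    rw [layerCW, if_neg (Finset.mem_erase.1 hy').1, Finset.sum_filter]
  rw [Finset.sum_congr rfl h2, Finset.sum_comm]
  have h3 : ∀ t, ∑ y' ∈ Finset.univ.erase y, (if y ∈ iLinks i (supp t) ∧ y' ∈ iLinks i (supp t) then B t else 0) =
      if y ∈ iLinks i (supp t) then B t * (((iLinks i (supp t)).card : ℝ) - 1) else 0 := by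
    intro t
    split_ifs with hyt
    · have : ∑ y' ∈ Finset.univ.erase y, (if y ∈ iLinks i (supp t) ∧ y' ∈ iLinks i (supp t) then B t else 0) =
          ∑ y' ∈ Finset.univ.erase y, (if y' ∈ iLinks i (supp t) then B t else 0) :=
        Finset.sum_congr rfl fun y' _ => by simp [hyt]
      rw [this, ← Finset.sum_filter, Finset.sum_const, nsmul_eq_mul, mul_comm]
      congr 1
      have hset : (Finset.univ.erase y).filter (fun y' => y' ∈ iLinks i (supp t)) = (iLinks i (supp t)).erase y := by
        ext y'; simp [Finset.mem_erase, and_comm]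
      rw [hset, Finset.card_erase_of_mem hyt, Nat.cast_sub (Finset.card_pos.2 ⟨y, hyt⟩), Nat.cast_one]
    · exact Finset.sum_eq_zero fun y' _ => by simp [hyt]
  rw [Finset.sum_congr rfl fun t _ => h3 t, ← Finset.sum_filter]

end Influence

/-! ### The windowed profile -/

omit [NeZero L] [NeZero N] in
/-- Triangle inequality for the `j`-distance profile. [folklore] -/
theorem jDist_triangle (j : Fin d) (t y' y : Site d L) : jDist j t y ≤ jDist j t y' + jDist j y' y := by
  unfold jDist
  have h := ZMod.natAbs_valMinAbs_add_le (y' j - t j) (y j - y' j)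
  rw [show y' j - t j + (y j - y' j) = y j - t j by ring] at h
  exact h.trans (Int.natAbs_add_le _ _)

/-- The windowed profile `⌈dist_j(t, y)/r⌉`. [folklore] -/
def profile (j : Fin d) (r : ℕ) (t y : Site d L) : ℕ := (jDist j t y + r - 1) / r

omit [NeZero L] [NeZero N] in
/-- The profile vanishes at the conditioned site. [folklore] -/
theorem profile_self (j : Fin d) {r : ℕ} (hr : 0 < r) (t : Site d L) : profile j r t t = 0 := by
  rw [profile, jDist_self, zero_add]; exact Nat.div_eq_of_lt (by omega)

omit [NeZero L] [NeZero N] in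
/-- The profile is `1`-Lipschitz between sites at `j`-distance `≤ r`. [folklore] -/
theorem profile_le_of_jDist_le (j : Fin d) {r : ℕ} (hr : 0 < r) (t : Site d L) {y y' : Site d L}
    (h : jDist j y' y ≤ r) : profile j r t y ≤ profile j r t y' + 1 := by
  unfold profile
  have h1 : jDist j t y + r - 1 ≤ (jDist j t y' + r - 1) + r := by
    have := jDist_triangle j t y' y; omega
  calc (jDist j t y + r - 1) / r ≤ ((jDist j t y' + r - 1) + r) / r := Nat.div_le_div_right h1
    _ = (jDist j t y' + r - 1) / r + 1 := Nat.add_div_right _ hr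

omit [NeZero N] in
/-- At the rung sites the profile is `⌈T/r⌉`. [folklore] -/
theorem profile_rung {i j : Fin d} (hij : i ≠ j) {r : ℕ} (x : Site d L) (n T : ℕ) (hT : 2 * T ≤ L) :
    profile j r (top x i j T n) (bot x i n) = (T + r - 1) / r := by
  rw [profile, show jDist j (top x i j T n) (bot x i n) = T from jDist_rung hij x n T hT]

omit [NeZero L] [NeZero N] [Fintype ι] in
/-- **The profile is `1`-Lipschitz along the influence graph** when every term's `i`-links have `j`-extent `≤ r`. [folklore] -/
theorem profile_le_of_mem_layerNbrW [NeZero L] [Fintype ι] (supp : ι → Finset (Plaquette d L)) (i j : Fin d) {r : ℕ}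
    (hr : 0 < r) (hext : ∀ t, ∀ y ∈ iLinks i (supp t), ∀ y' ∈ iLinks i (supp t), jDist j y' y ≤ r) (t₀ y : Site d L)
    {y' : Site d L} (hy' : y' ∈ layerNbrW supp i y) : profile j r t₀ y ≤ profile j r t₀ y' + 1 := by
  rw [layerNbrW, Finset.mem_filter] at hy'
  obtain ⟨t, hyt, hy't⟩ := hy'.2.2
  exact profile_le_of_jDist_le j hr t₀ (hext t y hyt y' hy't)

/-! ### The windowed two-point bound -/

/-- **Two-point bound of the block-conditioned system** (`N ≥ 2`): flux-local terms with `DependsOn` supports, bounds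
`|g t| ≤ B t`, row sums `∑_{t ∋ y} B t (|iLinks i (supp t)| − 1) ≤ c ≤ 1`, `j`-extents `≤ r` (`0 < r`) ⇒ for every selected
set `H`, transverse `kT`, frozen `κ` and sites `b, t`: `‖E ψ(σ_b − σ_t)‖ ≤ 4 · c^{⌈dist_j(t,b)/r⌉}`. [folklore] -/
theorem norm_cavg_ψ_sub_le_window (hN : 2 ≤ N) {supp : ι → Finset (Plaquette d L)}
    {g : ι → (Plaquette d L → ZMod N) → ℝ} {B : ι → ℝ}
    (hdep : ∀ t, DependsOn (g t) (↑(supp t) : Set (Plaquette d L))) (hB0 : ∀ t, 0 ≤ B t) (hB : ∀ t φ, |g t φ| ≤ B t)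
    (i j : Fin d) {c : ℝ}
    (hrow : ∀ y : Site d L, ∑ t ∈ Finset.univ.filter (fun t => y ∈ iLinks i (supp t)),
      B t * (((iLinks i (supp t)).card : ℝ) - 1) ≤ c)
    (hc1 : c ≤ 1) {r : ℕ} (hr : 0 < r) (hext : ∀ t, ∀ y ∈ iLinks i (supp t), ∀ y' ∈ iLinks i (supp t), jDist j y' y ≤ r)
    (H : Finset (ZMod L)) (kT : Transverse d L (ZMod N) i) (κ : Site d L → ZMod N) (b t : Site d L) :
    ‖FiniteGibbs.cavg (layerWeightW g i H kT κ) (fun σ => ψ N (σ b - σ t))‖ ≤ 4 * c ^ profile j r t b := by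
  classical
  have hc0 : 0 ≤ c := by
    refine le_trans (Finset.sum_nonneg fun t' ht' => mul_nonneg (hB0 t') ?_) (hrow b)
    have hb : b ∈ iLinks i (supp t') := (Finset.mem_filter.1 ht').2
    have h1 : (1 : ℝ) ≤ ((iLinks i (supp t')).card : ℝ) := by exact_mod_cast Finset.card_pos.2 ⟨b, hb⟩
    linarith
  exact ZNSpin.norm_cavg_ψ_sub_le_of_shift hN (layerWeightW_pos g i H kT κ)
    (fun σ => layerWeightW_add_const g i H kT κ σ 1) (C := layerCW supp B i) (nbr := layerNbrW supp i)
    (layerCW_nonneg supp B i hB0) (layerCW_eq_zero supp B i)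
    (fun y y' hy σ τ hστ => tv_layerWeightW_le supp B i hdep hB H kT κ y y' hy σ τ hστ) hc0 hc1
    (fun y => (rowsum_layerCW_le supp B i hB0 y).trans (hrow y)) t (profile j r t) (profile_self j hr t)
    (fun y _ y' hy' => profile_le_of_mem_layerNbrW supp i j hr hext t y hy') b

end ZNFluxW

end Summit.Ventures.YMGap.RobustBall

end
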